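import Mathlib
import HarnessLib
import Summits.HubbardSuperconductivity.HubbardSuperconductivity.Theorems.KLProgrammeKLRegimeVolumeLimitModulus
import Summits.HubbardSuperconductivity.HubbardSuperconductivity.Theorems.KLProgrammeKLRegimeTwoLegKernelMomentsModulus
import Summits.HubbardSuperconductivity.HubbardSuperconductivity.Theorems.KLProgrammeKLRegimeVolumeLimitZeroCouplingRate

/-!
# THE FRAMED ONE-VOLUME MOMENTUM MODULUS OF THE VL CARRIER IS A THEOREM: `FramedCarrierModulusText Pr W` holds for every bundle and window
# — the conclusion of k3c5-p1's corollary `CarrierModulusOfTwoLegMoments` WITHOUT its hypothesis (E3-M)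
# (seat hubbard-kl-k3c5-p3 g6, technique «OS-positivity-free direct assembly»; `--supports` the VL child, stmt-…-19921 / gen-6 successor)

Route `KLProgramme`, crux K3, child VOLUME-LIMIT.  `…VolumeLimitModulus` (this seat) proved the BARE-frame modulus (M) for every coupling.  The engine
exports its two-leg kernel in its OWN frame `K` (`klSelfEnergy L M β U μ K klE0 (nScales β + 1)`), and the framed doors
(`volumeLimitP2_of_framedNestedText`, k3c5-p2's `framedCarrierRate_of_nestedFramed`) want the modulus IN THAT FRAME — typed by k3c5-p1 g6 as
`KLRegimeSplit.FramedCarrierModulusText Pr W` (…TwoLegKernelMomentsDefs), there obtained from the engine-private invariant (E3-M)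
`TwoLegKernelMoments` along the tower (`carrierModulusOfTwoLegMoments_holds`).  Here it is proved OUTRIGHT:

* §1 the frame dressing in closed form at a continuum momentum `q` (`g₀ = propInt β μ 0 n q`, `D_K = D₀ − K(q)`):
  `g₀/g_K = 1 − K(q)·g₀` and (this seat's `propInt_sub_div_sq_eq`) `(g_K − g₀)/g_K² = K(q)·g₀/g_K`, so `Σ∞^K = (1 − K g₀)²·Σ∞⁰ + K(1 − K g₀)`
  (`klSelfEnergyInf_eq_dressing`);
* §2 label-uniform sizes and moduli of the ingredients: `‖g₀‖ ≤ β/π`, `‖g₀(q₁) − g₀(q₂)‖ ≤ 2(β/π)²·Σ_i|Δq_i|_𝕋` (bare band: `|cos a − cos b| ≤ |a−b|_𝕋`,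
  k3c4-p1), `|K(q)| ≤ ‖K‖₀`, `|K(p_{k₁}) − K(p_{k₂})| ≤ 2‖K‖₁·Σ_i|Δp_i|_𝕋` (k3c5-p1's `abs_eval_latticeMomentum_sub_le`), `‖Σ∞⁰‖ ≤ 3|U|/2 + 9βU²/4`;
* §3 `norm_klSelfEnergyInf_frame_sub_le` — `∃ D_K(β,U,μ,K) ∀ L ≥ 3 ∀ n k₁ k₂: ‖Σ∞^K_L(n,k₁) − Σ∞^K_L(n,k₂)‖ ≤ D_K·Σ_i|Δp_i|_𝕋` (`U ≠ 0`);
* §4 finite cutoffs in the frame `K` (`klSelfEnergy_cutoffLimit_labelUniform`, any frame) and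
  **`framedCarrierModulusText_holds (Pr W) : FramedCarrierModulusText Pr W`** for EVERY `Pr`, `W` (`L₀ = 3`, `ρ′ L = 1/(L+1)`);
* §5 **`volumeLimitP2_of_framedNestedOnlyText (Pr W) hN`** — a VL child of any generation from the FRAMED NESTED export ALONE (`L ∣ L″`, equal
  momenta, common cutoff, the engine's own frame `K`; no frame-class hypothesis, no modulus, no site moments).

Everything is proved; no definition; nothing is asserted about the model beyond the tree's identities.
-/

noncomputable section

namespace Summit.HubbardSuperconductivity.HubbardSuperconductivity.Theorems.TwoPointAssembly

set_option linter.dupNamespace false -- summit = problem name (single-conjunct summit), D-0017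

open Finset Filter Topology Complex Literature.MathematicalPhysics.QuantumLattice Literature.Probability.LatticeModels
open Literature.MathematicalPhysics.QuantumLattice.FermiRG
open Summit.HubbardSuperconductivity.HubbardSuperconductivity.Theorems.DispersionFlow
open Summit.HubbardSuperconductivity.HubbardSuperconductivity.Theorems.KLRegimeSplit
open Summit.HubbardSuperconductivity.HubbardSuperconductivity.Theorems.KLProgrammeLegKernels

/-! ## §1 The frame dressing in closed form -/

/-- `D_K(q) = D₀(q) − K(q)`: the framed denominator is the bare one minus the frame value. -/
theorem propInt_den_frame_eq (β μ : ℝ) (K : TrigPolyC4v) (n : ℤ) (q : Fin 2 → ℝ) :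
    (-Complex.I * (freqOfInt β n : ℂ) + (bandCT μ K q : ℂ)) = (-Complex.I * (freqOfInt β n : ℂ) + (bandCT μ 0 q : ℂ)) - (K.eval q : ℂ) := by
  simp only [bandCT, TrigPolyC4v.eval_zero]
  push_cast
  ring

/-- **`g₀/g_K = 1 − K(q)·g₀`** (`β ≠ 0`). -/
theorem propInt_zero_div_propInt_eq {β : ℝ} (hβ : β ≠ 0) (μ : ℝ) (K : TrigPolyC4v) (n : ℤ) (q : Fin 2 → ℝ) :
    propInt β μ 0 n q / propInt β μ K n q = 1 - (K.eval q : ℂ) * propInt β μ 0 n q := by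
  have hD0 := propInt_den_ne_zero hβ μ 0 n q
  have hDK := propInt_den_ne_zero hβ μ K n q
  set D₀ : ℂ := -Complex.I * (freqOfInt β n : ℂ) + (bandCT μ 0 q : ℂ) with hD₀
  have hrel : (-Complex.I * (freqOfInt β n : ℂ) + (bandCT μ K q : ℂ)) = D₀ - (K.eval q : ℂ) := propInt_den_frame_eq β μ K n q
  rw [hrel] at hDK
  have h0 : propInt β μ 0 n q = 1 / D₀ := rfl
  have hK : propInt β μ K n q = 1 / (D₀ - (K.eval q : ℂ)) := by rw [propInt, hrel]
  rw [h0, hK]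
  field_simp

/-- **The framed cutoff-free carrier from the bare one, closed form**: `Σ∞^K = (1 − K g₀)²·Σ∞⁰ + K·(1 − K g₀)` at `q = p_k`
(`klSelfEnergyInf_eq_dressing` + `propInt_sub_div_sq_eq` + `propInt_zero_div_propInt_eq`). -/
theorem klSelfEnergyInf_frame_closedForm {L : ℕ} [NeZero L] {β : ℝ} (hβ : β ≠ 0) (U μ : ℝ) (K : TrigPolyC4v) (n : ℤ) (p : TorusSite 2 L) :
    klSelfEnergyInf L β U μ K n p =
      (1 - (K.eval (latticeMomentum L p) : ℂ) * propInt β μ 0 n (latticeMomentum L p)) ^ 2 * klSelfEnergyInf L β U μ 0 n p +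
        (K.eval (latticeMomentum L p) : ℂ) * (1 - (K.eval (latticeMomentum L p) : ℂ) * propInt β μ 0 n (latticeMomentum L p)) := by
  rw [klSelfEnergyInf_eq_dressing hβ U μ K n p, propInt_sub_div_sq_eq hβ, propInt_zero_div_propInt_eq hβ]

/-! ## §2 Label-uniform sizes and moduli of the ingredients -/

/-- `‖g₀‖ ≤ β/π` at every label and momentum (`β > 0`). -/
theorem norm_propInt_zero_le {β : ℝ} (hβ : 0 < β) (μ : ℝ) (n : ℤ) (q : Fin 2 → ℝ) : ‖propInt β μ 0 n q‖ ≤ β / Real.pi := by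
  have hω : Real.pi / β ≤ |freqOfInt β n| := by
    have h := Literature.MathematicalPhysics.QuantumLattice.pi_div_le_abs_fermiMatsubara hβ n
    simp only [fermiMatsubara] at h
    exact h
  have hω0 : freqOfInt β n ≠ 0 := freqOfInt_ne_zero hβ.ne' n
  rw [propInt]
  refine (norm_one_div_le hω0 _).trans ?_
  rw [div_le_div_iff₀ (abs_pos.mpr hω0) Real.pi_pos, one_mul]
  have := mul_le_mul_of_nonneg_right hω hβ.le
  rwa [div_mul_cancel₀ _ hβ.ne', mul_comm] at this

/-- The bare band is torus-Lipschitz with constant `2`: `|e(q₁) − e(q₂)| ≤ 2·Σ_i |q₁,ᵢ − q₂,ᵢ|_𝕋`. -/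
theorem abs_bandCT_zero_sub_le (μ : ℝ) (q₁ q₂ : Fin 2 → ℝ) :
    |bandCT μ 0 q₁ - bandCT μ 0 q₂| ≤ 2 * ∑ i, torusAbs (q₁ i - q₂ i) := by
  have h : bandCT μ 0 q₁ - bandCT μ 0 q₂ = -2 * ∑ i, (Real.cos (q₁ i) - Real.cos (q₂ i)) := by
    simp only [bandCT, TrigPolyC4v.eval_zero, Finset.sum_sub_distrib]; ring
  rw [h, abs_mul, abs_neg, abs_two]
  refine mul_le_mul_of_nonneg_left ((Finset.abs_sum_le_sum_abs _ _).trans (Finset.sum_le_sum fun i _ => ?_)) (by norm_num)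
  exact klvz_abs_cos_sub_cos_le_torusAbs _ _

/-- **`‖g₀(q₁) − g₀(q₂)‖ ≤ 2(β/π)²·Σ_i |q₁,ᵢ − q₂,ᵢ|_𝕋`** (label-uniform). -/
theorem norm_propInt_zero_sub_le {β : ℝ} (hβ : 0 < β) (μ : ℝ) (n : ℤ) (q₁ q₂ : Fin 2 → ℝ) :
    ‖propInt β μ 0 n q₁ - propInt β μ 0 n q₂‖ ≤ 2 * (β / Real.pi) ^ 2 * ∑ i, torusAbs (q₁ i - q₂ i) := by
  have hD1 := propInt_den_ne_zero hβ.ne' μ 0 n q₁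
  have hD2 := propInt_den_ne_zero hβ.ne' μ 0 n q₂
  set D₁ : ℂ := -Complex.I * (freqOfInt β n : ℂ) + (bandCT μ 0 q₁ : ℂ) with hD₁
  set D₂ : ℂ := -Complex.I * (freqOfInt β n : ℂ) + (bandCT μ 0 q₂ : ℂ) with hD₂
  have hband : (bandCT μ 0 q₂ : ℂ) - (bandCT μ 0 q₁ : ℂ) = D₂ - D₁ := by rw [hD₁, hD₂]; ring
  have hid : propInt β μ 0 n q₁ - propInt β μ 0 n q₂ =
      propInt β μ 0 n q₁ * propInt β μ 0 n q₂ * ((bandCT μ 0 q₂ : ℂ) - (bandCT μ 0 q₁ : ℂ)) := by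
    rw [hband, show propInt β μ 0 n q₁ = 1 / D₁ from rfl, show propInt β μ 0 n q₂ = 1 / D₂ from rfl]
    field_simp
  rw [hid, norm_mul, norm_mul, ← Complex.ofReal_sub, Complex.norm_real, Real.norm_eq_abs, abs_sub_comm]
  have h1 := norm_propInt_zero_le hβ μ n q₁
  have h2 := norm_propInt_zero_le hβ μ n q₂
  have h3 := abs_bandCT_zero_sub_le μ q₁ q₂
  have hβπ : 0 ≤ β / Real.pi := div_nonneg hβ.le Real.pi_pos.le
  calc ‖propInt β μ 0 n q₁‖ * ‖propInt β μ 0 n q₂‖ * |bandCT μ 0 q₁ - bandCT μ 0 q₂|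
      ≤ (β / Real.pi) * (β / Real.pi) * (2 * ∑ i, torusAbs (q₁ i - q₂ i)) :=
        mul_le_mul (mul_le_mul h1 h2 (norm_nonneg _) hβπ) h3 (abs_nonneg _) (by positivity)
    _ = 2 * (β / Real.pi) ^ 2 * ∑ i, torusAbs (q₁ i - q₂ i) := by ring

/-! ## §3 The framed cutoff-free modulus -/

/-- **`‖Σ∞^K_L(n,k₁) − Σ∞^K_L(n,k₂)‖ ≤ D_K·Σ_i |p_{k₁,i} − p_{k₂,i}|_𝕋`** with `D_K = D_K(β,U,μ,K)` independent of `L ≥ 3`, the label and the momenta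
(`U ≠ 0`, `β > 0`; every frame `K`). -/
theorem norm_klSelfEnergyInf_frame_sub_le (U μ : ℝ) {β : ℝ} (hβ : 0 < β) (hU : U ≠ 0) (K : TrigPolyC4v) :
    ∃ D : ℝ, ∀ (L : ℕ) [NeZero L], 3 ≤ L → ∀ (n : ℤ) (k₁ k₂ : TorusSite 2 L),
      ‖klSelfEnergyInf L β U μ K n k₁ - klSelfEnergyInf L β U μ K n k₂‖ ≤ D * ∑ i, torusAbs (latticeMomentum L k₁ i - latticeMomentum L k₂ i) := by
  obtain ⟨D₀, hD₀⟩ := norm_klSelfEnergyInf_zero_sub_le U μ hβ hU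
  -- the constants
  set b : ℝ := β / Real.pi with hb
  have hb0 : 0 ≤ b := div_nonneg hβ.le Real.pi_pos.le
  set K₀ : ℝ := K.coeffNorm 0 with hK₀
  set K₁ : ℝ := K.coeffNorm 1 with hK₁
  have hK₀0 : 0 ≤ K₀ := TrigPolyC4v.coeffNorm_nonneg 0 K
  have hK₁0 : 0 ≤ K₁ := TrigPolyC4v.coeffNorm_nonneg 1 K
  set R : ℝ := 1 + K₀ * b with hR
  have hR0 : 0 ≤ R := by positivity
  set B : ℝ := 3 / 2 * |U| + 9 / 4 * β * U ^ 2 with hB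
  have hB0 : 0 ≤ B := by positivity
  set a : ℝ := 2 * K₁ * b + K₀ * (2 * b ^ 2) with ha
  set D₀' : ℝ := max D₀ 0 with hD₀'
  have hD₀'0 : 0 ≤ D₀' := le_max_right _ _
  refine ⟨a * (2 * R) * B + R ^ 2 * D₀' + 2 * K₁ + (2 * K₁ * (2 * K₀) * b + K₀ ^ 2 * (2 * b ^ 2)), ?_⟩
  intro L _ hL n k₁ k₂
  set q₁ : Fin 2 → ℝ := latticeMomentum L k₁ with hq₁
  set q₂ : Fin 2 → ℝ := latticeMomentum L k₂ with hq₂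
  set Θ : ℝ := ∑ i, torusAbs (q₁ i - q₂ i) with hΘ
  have hΘ0 : 0 ≤ Θ := Finset.sum_nonneg fun i _ => abs_nonneg _
  set g₁ : ℂ := propInt β μ 0 n q₁ with hg₁
  set g₂ : ℂ := propInt β μ 0 n q₂ with hg₂
  set κ₁ : ℂ := (K.eval q₁ : ℂ) with hκ₁
  set κ₂ : ℂ := (K.eval q₂ : ℂ) with hκ₂
  set S₁ : ℂ := klSelfEnergyInf L β U μ 0 n k₁ with hS₁
  set S₂ : ℂ := klSelfEnergyInf L β U μ 0 n k₂ with hS₂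
  -- ingredient bounds
  have hg1 : ‖g₁‖ ≤ b := norm_propInt_zero_le hβ μ n q₁
  have hg2 : ‖g₂‖ ≤ b := norm_propInt_zero_le hβ μ n q₂
  have hg12 : ‖g₁ - g₂‖ ≤ 2 * b ^ 2 * Θ := norm_propInt_zero_sub_le hβ μ n q₁ q₂
  have hκ1 : ‖κ₁‖ ≤ K₀ := by rw [hκ₁, Complex.norm_real, Real.norm_eq_abs]; exact TrigPolyC4v.abs_eval_le_coeffNorm K q₁
  have hκ2 : ‖κ₂‖ ≤ K₀ := by rw [hκ₂, Complex.norm_real, Real.norm_eq_abs]; exact TrigPolyC4v.abs_eval_le_coeffNorm K q₂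
  have hκ12 : ‖κ₁ - κ₂‖ ≤ 2 * K₁ * Θ := by
    rw [hκ₁, hκ₂, ← Complex.ofReal_sub, Complex.norm_real, Real.norm_eq_abs]
    exact abs_eval_latticeMomentum_sub_le K k₁ k₂
  have hS1 : ‖S₁‖ ≤ B := norm_klSelfEnergyInf_zero_le hL hβ hU μ n k₁
  have hS12 : ‖S₁ - S₂‖ ≤ D₀' * Θ := (hD₀ L hL n k₁ k₂).trans (mul_le_mul_of_nonneg_right (le_max_left _ _) hΘ0)
  have hA1 : ‖1 - κ₁ * g₁‖ ≤ R := by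
    refine (norm_sub_le _ _).trans ?_
    rw [norm_one, norm_mul, hR]
    linarith [mul_le_mul hκ1 hg1 (norm_nonneg _) hK₀0]
  have hA2 : ‖1 - κ₂ * g₂‖ ≤ R := by
    refine (norm_sub_le _ _).trans ?_
    rw [norm_one, norm_mul, hR]
    linarith [mul_le_mul hκ2 hg2 (norm_nonneg _) hK₀0]
  have hA12 : ‖(1 - κ₁ * g₁) - (1 - κ₂ * g₂)‖ ≤ a * Θ := by
    have e : (1 - κ₁ * g₁) - (1 - κ₂ * g₂) = (κ₂ - κ₁) * g₂ + κ₁ * (g₂ - g₁) := by ring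
    rw [e]
    refine (norm_add_le _ _).trans ?_
    rw [norm_mul, norm_mul, norm_sub_rev κ₂ κ₁, norm_sub_rev g₂ g₁]
    calc ‖κ₁ - κ₂‖ * ‖g₂‖ + ‖κ₁‖ * ‖g₁ - g₂‖ ≤ (2 * K₁ * Θ) * b + K₀ * (2 * b ^ 2 * Θ) :=
          add_le_add (mul_le_mul hκ12 hg2 (norm_nonneg _) (by positivity)) (mul_le_mul hκ1 hg12 (norm_nonneg _) hK₀0)
      _ = a * Θ := by rw [ha]; ring
  -- the four terms
  have T1 : ‖((1 - κ₁ * g₁) ^ 2 - (1 - κ₂ * g₂) ^ 2) * S₁‖ ≤ a * Θ * (2 * R) * B := by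
    rw [norm_mul, sq_sub_sq, norm_mul]
    refine mul_le_mul ?_ hS1 (norm_nonneg _) (by positivity)
    rw [mul_comm]
    refine mul_le_mul hA12 ((norm_add_le _ _).trans ?_) (norm_nonneg _) (by positivity)
    linarith
  have T2 : ‖(1 - κ₂ * g₂) ^ 2 * (S₁ - S₂)‖ ≤ R ^ 2 * (D₀' * Θ) := by
    rw [norm_mul, norm_pow]
    exact mul_le_mul (pow_le_pow_left₀ (norm_nonneg _) hA2 2) hS12 (norm_nonneg _) (by positivity)
  have T4 : ‖κ₁ ^ 2 * g₁ - κ₂ ^ 2 * g₂‖ ≤ 2 * K₁ * Θ * (2 * K₀) * b + K₀ ^ 2 * (2 * b ^ 2 * Θ) := by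
    have e : κ₁ ^ 2 * g₁ - κ₂ ^ 2 * g₂ = (κ₁ - κ₂) * (κ₁ + κ₂) * g₁ + κ₂ ^ 2 * (g₁ - g₂) := by ring
    rw [e]
    refine (norm_add_le _ _).trans (add_le_add ?_ ?_)
    · rw [norm_mul, norm_mul]
      refine mul_le_mul (mul_le_mul hκ12 ((norm_add_le _ _).trans (by linarith)) (norm_nonneg _) (by positivity)) hg1
        (norm_nonneg _) (by positivity)
    · rw [norm_mul, norm_pow]
      exact mul_le_mul (pow_le_pow_left₀ (norm_nonneg _) hκ2 2) hg12 (norm_nonneg _) (by positivity)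
  -- assembly
  have hclosed₁ := klSelfEnergyInf_frame_closedForm hβ.ne' U μ K n k₁
  have hclosed₂ := klSelfEnergyInf_frame_closedForm hβ.ne' U μ K n k₂
  have e : klSelfEnergyInf L β U μ K n k₁ - klSelfEnergyInf L β U μ K n k₂ =
      ((1 - κ₁ * g₁) ^ 2 - (1 - κ₂ * g₂) ^ 2) * S₁ + (1 - κ₂ * g₂) ^ 2 * (S₁ - S₂) + (κ₁ - κ₂) - (κ₁ ^ 2 * g₁ - κ₂ ^ 2 * g₂) := by
    rw [hclosed₁, hclosed₂]; ring
  rw [e]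
  calc ‖((1 - κ₁ * g₁) ^ 2 - (1 - κ₂ * g₂) ^ 2) * S₁ + (1 - κ₂ * g₂) ^ 2 * (S₁ - S₂) + (κ₁ - κ₂) - (κ₁ ^ 2 * g₁ - κ₂ ^ 2 * g₂)‖
      ≤ ‖((1 - κ₁ * g₁) ^ 2 - (1 - κ₂ * g₂) ^ 2) * S₁‖ + ‖(1 - κ₂ * g₂) ^ 2 * (S₁ - S₂)‖ + ‖κ₁ - κ₂‖ + ‖κ₁ ^ 2 * g₁ - κ₂ ^ 2 * g₂‖ :=
        (norm_sub_le _ _).trans (add_le_add ((norm_add_le _ _).trans (add_le_add (norm_add_le _ _) le_rfl)) le_rfl)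
    _ ≤ a * Θ * (2 * R) * B + R ^ 2 * (D₀' * Θ) + 2 * K₁ * Θ + (2 * K₁ * Θ * (2 * K₀) * b + K₀ ^ 2 * (2 * b ^ 2 * Θ)) :=
        add_le_add (add_le_add (add_le_add T1 T2) hκ12) T4
    _ = (a * (2 * R) * B + R ^ 2 * D₀' + 2 * K₁ + (2 * K₁ * (2 * K₀) * b + K₀ ^ 2 * (2 * b ^ 2))) * Θ := by ring

/-! ## §4 Finite cutoffs in the frame `K`, and the framed modulus text -/

/-- **The framed momentum modulus at finite cutoff**: with `D_K` from §3, for every `L ≥ 3` there is `M₀` with, for all `M ≥ M₀`, ALL labels and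
momenta: `‖Σ̂^K_{L,M}(ω,k₁) − Σ̂^K_{L,M}(ω,k₂)‖ ≤ 1/(L+1) + D_K·Σ_i|Δp_i|_𝕋` (label-uniform cutoff removal in the frame `K`). -/
theorem klSelfEnergy_framedMomentumModulus_eventually (U μ : ℝ) {β : ℝ} (hβ : 0 < β) (hU : U ≠ 0) (K : TrigPolyC4v) :
    ∃ D : ℝ, ∀ (L : ℕ) [NeZero L], 3 ≤ L → ∃ M₀ : ℕ, ∀ (M : ℕ) [NeZero M], M₀ ≤ M →
      ∀ (ω : MatsubaraIdx M) (k₁ k₂ : TorusSite 2 L),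
        ‖klSelfEnergy L M β U μ K klE0 (nScales β + 1) (ω, k₁) 0 - klSelfEnergy L M β U μ K klE0 (nScales β + 1) (ω, k₂) 0‖ ≤
          1 / ((L : ℝ) + 1) + D * ∑ i, torusAbs (latticeMomentum L k₁ i - latticeMomentum L k₂ i) := by
  obtain ⟨D, hD⟩ := norm_klSelfEnergyInf_frame_sub_le U μ hβ hU K
  refine ⟨D, fun L _ hL => ?_⟩
  have hε : (0 : ℝ) < 1 / (2 * ((L : ℝ) + 1)) := by positivity
  obtain ⟨M₁, hM₁⟩ := klSelfEnergy_cutoffLimit_labelUniform hL hβ U μ K hε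
  refine ⟨M₁, fun M _ hM ω k₁ k₂ => ?_⟩
  have h1 := hM₁ M hM ω k₁ 0
  have h2 := hM₁ M hM ω k₂ 0
  have h3 := hD L hL (matsubaraInt M ω) k₁ k₂
  calc ‖klSelfEnergy L M β U μ K klE0 (nScales β + 1) (ω, k₁) 0 - klSelfEnergy L M β U μ K klE0 (nScales β + 1) (ω, k₂) 0‖
      = ‖(klSelfEnergy L M β U μ K klE0 (nScales β + 1) (ω, k₁) 0 - klSelfEnergyInf L β U μ K (matsubaraInt M ω) k₁) +
          (klSelfEnergyInf L β U μ K (matsubaraInt M ω) k₁ - klSelfEnergyInf L β U μ K (matsubaraInt M ω) k₂) -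
          (klSelfEnergy L M β U μ K klE0 (nScales β + 1) (ω, k₂) 0 - klSelfEnergyInf L β U μ K (matsubaraInt M ω) k₂)‖ := by
        congr 1; ring
    _ ≤ ‖klSelfEnergy L M β U μ K klE0 (nScales β + 1) (ω, k₁) 0 - klSelfEnergyInf L β U μ K (matsubaraInt M ω) k₁‖ +
          ‖klSelfEnergyInf L β U μ K (matsubaraInt M ω) k₁ - klSelfEnergyInf L β U μ K (matsubaraInt M ω) k₂‖ +
          ‖klSelfEnergy L M β U μ K klE0 (nScales β + 1) (ω, k₂) 0 - klSelfEnergyInf L β U μ K (matsubaraInt M ω) k₂‖ :=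
        (norm_sub_le _ _).trans (add_le_add (norm_add_le _ _) le_rfl)
    _ ≤ 1 / (2 * ((L : ℝ) + 1)) + D * ∑ i, torusAbs (latticeMomentum L k₁ i - latticeMomentum L k₂ i) + 1 / (2 * ((L : ℝ) + 1)) :=
        add_le_add (add_le_add h1 h3) h2
    _ = 1 / ((L : ℝ) + 1) + D * ∑ i, torusAbs (latticeMomentum L k₁ i - latticeMomentum L k₂ i) := by
        field_simp; ring

/-- **`FramedCarrierModulusText Pr W` HOLDS for every bundle `Pr` and window `W`** — the conclusion of k3c5-p1's corollary
`CarrierModulusOfTwoLegMoments Pr W` without its (E3-M) hypothesis: the one-volume momentum modulus of the last-scale two-leg kernel in the frame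
`K` of the binders, `L₀ = 3`, `ρ′ L = 1/(L+1)`, `D = D_K(β,U,μ,K)` (the tower, the frame class and the regime are not used). -/
theorem framedCarrierModulusText_holds (Pr : Preds) (W : Set ℝ) : FramedCarrierModulusText Pr W := by
  intro G P Q R _ _ _ _
  refine ⟨1, one_pos, fun c _ _ => ⟨1, one_pos, ?_⟩⟩
  intro μ _ U hU _ β hβmin _ K _ Lstar Mstar _
  have hβ : 0 < β := pos_of_klBetaMin_le hβmin
  obtain ⟨D, hD⟩ := klSelfEnergy_framedMomentumModulus_eventually U μ hβ hU.ne' K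
  refine ⟨3, D, fun L => 1 / ((L : ℝ) + 1), tendsto_one_div_add_atTop_nhds_zero_nat, fun L _ hL => ?_⟩
  exact hD L hL

/-! ## §5 A VL child from the FRAMED NESTED export alone -/

/-- **A VL child (any `Pr`, `W`) FROM THE FRAMED NESTED EXPORT ALONE**: nested volumes `L ∣ L″`, equal momenta, common cutoff, the engine's own frame
`K` of the binders, one rate `ρ L → 0` — no frame-class hypothesis, no modulus, no site moments. -/
theorem volumeLimitP2_of_framedNestedOnlyText (Pr : Preds) (W : Set ℝ)
    (hN : ∀ (G : GeoConsts) (P : SplitConsts) (Q : EngConsts) (R : RenConsts), G.WF → P.WF → Q.WF → R.WF →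
      ∃ c₅ : ℝ, 0 < c₅ ∧ ∀ c : ℝ, 0 < c → c ≤ c₅ → ∃ U₀ : ℝ, 0 < U₀ ∧
        ∀ μ ∈ W, ∀ U : ℝ, 0 < U → U ≤ U₀ → ∀ β : ℝ, klBetaMin ≤ β → β ≤ Real.exp (c / U ^ 2) →
          ∀ K : TrigPolyC4v, Pr.frameOK R U (nScales β) μ K →
            ∀ (Lstar : ℕ) (Mstar : ℕ → ℕ), TowerP Pr G P Q R β U μ K Lstar Mstar →
              ∃ L₀ : ℕ, ∃ ρ : ℕ → ℝ, Tendsto ρ atTop (𝓝 0) ∧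
                ∀ (L : ℕ) [NeZero L], L₀ ≤ L → ∀ (L'' : ℕ) [NeZero L''], L ∣ L'' → ∃ M₀ : ℕ, ∀ (M : ℕ) [NeZero M], M₀ ≤ M →
                  ∀ (ω : MatsubaraIdx M) (k : TorusSite 2 L) (k'' : TorusSite 2 L''), latticeMomentum L'' k'' = latticeMomentum L k →
                    ‖klSelfEnergy L M β U μ K klE0 (nScales β + 1) (ω, k) 0 -
                        klSelfEnergy L'' M β U μ K klE0 (nScales β + 1) (ω, k'') 0‖ ≤ ρ L) :
    VolumeLimitP2 Pr FinalTwoLegVolLimitEx W :=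
  volumeLimitP2_of_framedNestedText Pr W hN (framedCarrierModulusText_holds Pr W)

end Summit.HubbardSuperconductivity.HubbardSuperconductivity.Theorems.TwoPointAssembly

end
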